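import Summits.NavierStokesRegularity.NavierStokesRegularity.Theorems.ScenarioCensusRowF1DenseLocus
import HarnessLib

/-!
# LINE 31 «dense-locus» port, part 2/2: §7 TWO INSTANCES — analytic rigidity of slices of `𝒦`, the BELTRAMI locus (Lamb defect `lambOf`) and the IRROTATIONAL locus
# (`vortOf`), the two KILLS (tree generalised-Beltrami Liouville + Mityagin BY NAME); §8 THE NAMED ROWS, FLOORS AND RESIDUALS (`Row_F1bel` / `Row_F1calm`, floors
# `RecurrentTwistedBalls` / `RecurrentVorticalBalls`, residuals ≡ `Row_F1`); census KEYS `Row_F1bel` / `Row_F1calm` + `_excluded`, floors RTB / RVB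

Re-homed for the scenario census (typer seat ns-census-typer-1 g9; the cells F1βd / F1ωd (+ generic F1[q]d) and the floors RTB / RVB are MEMBERS OF RECORD «DECIDED IN
KERNEL IN FILES» of row F1 since census v1.93 (critic idea-crit-3 g8 PASS 07:07:47Z — no price; ref ns-census-ref g12 PRE-CHECK ✓ §17.3 item 60; lead-presearch label
item 60); this port makes them TREE-decided): VERBATIM PORT of the NEW sections (§6–§8) of ns-idea-3 LINE 31 «dense-locus»,
`pub/ideators/ns-idea-3/lines/dense-locus/line-dense-locus.lean` sha16 021c430dd55ed4f0 (1297 l., lean check rc 0, 0 sorry; its §1–§5 = LINES 27–30 VERBATIM, taken BY NAME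
from `ScenarioCensusRowF1Socket*` / `…SharpTop*` / `…ThinTop*` / `…EventSocket*`), split for the 400-line rule into `ScenarioCensusRowF1DenseLocus` (§6) →
`…DenseLocusRows` (§7–§8 + census KEYS).  Lean text VERBATIM in namespace `…Theorems.ScenarioCensus.DenseLocus` (the line's `…Cruxes.ScenarioCensusRowF1.DenseLocusLine`
re-homed) with `open …LiouvilleSocket …SharpTop …ThinTop …EventSocket`; port edits: `@[conjecture]` on the residuals `BelSlack` / `CalmSlack` (≡ `ScenarioCensus.Row_F1`,
OPEN), one-line docstrings added where missing (gate lint), two uses of a lemma name that two opened ports both declare spelled with its namespace.  Statements untouched.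

No census VALUE is moved here (row F1 stays OPEN-WITH-LINE; the members become TREE-decided by name); NS regularity is NOT proved; `Row_F1` is untouched (zero
movement, `belSlack_iff_rowF1` / `calmSlack_iff_rowF1`); no summit statement is proved by this file. Lemmas that restate already-landed tree declarations are taken BY NAME (gate lint `dedup.landed`): `fderiv_smul_stPull_apply` = `InviscidTop.fderiv_smul_stPull_apply`, `fderiv_smul_stPull` = `InviscidTop.fderiv_smul_stPull`, `fderiv_fderiv_smul_stPull` = `InviscidTop.fderiv_fderiv_smul_stPull`, `tendsto_clm_of_tendsto_apply` = `InviscidTop.tendsto_clm_of_tendsto_apply`, `tendsto_fderiv_fderiv_apply_of_bound` = `InviscidTop.tendsto_fderiv_fderiv_apply_of_bound`, `tendsto_fderiv_fderiv_of_bound` = `InviscidTop.tendsto_fderiv_fderiv_of_bound`, `tendsto_fderiv_fderiv_of_typeI_seq_Ioo` = `InviscidTop.tendsto_fderiv_fderiv_of_typeI_seq_Ioo`, `fderiv3_smul_stPull` = `FrozenTop.fderiv3_smul_stPull`, `tendsto_fderiv3_of_typeI_seq_Ioo` = `FrozenTop.tendsto_fderiv3_of_typeI_seq_Ioo`, `tendsto_physicalTime`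 = `ColumnarTop.tendsto_physicalTime`, `eventually_fast` = `ColumnarTop.eventually_fast`, `sqrt_timeLag` = `StretchedTop.sqrt_timeLag`, `forall_of_forall_ne_zero` = `StretchedTop.forall_of_forall_ne_zero`, `radius_eq` = `FrozenTop.radius_eq`, `jointCond_everywhere₆` = `FrozenTop.jointCond_everywhere₄`, `continuousOn_quad` = `IntegratedStretch.continuousOn_quad`, `sqrt_nu_timeLag` = `IntegratedStretch.sqrt_nu_timeLag`, `sing_of_not_bounded` = `InviscidTop.sing_of_not_bounded`, `exists_singularZoom_package₃` = `FrozenTop.exists_singularZoom_package₃`, `lapD_eq_zero_of_eq_zero` = `FrozenTop.lapD_eq_zero_of_eq_zero`, `measurableSet_top` = `IntegratedStretch.measurableSet_top`.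
-/

-- the summit and its single problem share the name `NavierStokesRegularity` (D-0017 nested layout)
set_option linter.dupNamespace false

noncomputable section

open MeasureTheory Set Function Filter TopologicalSpace Metric
open scoped Topology NNReal ENNReal InnerProductSpace RealInnerProductSpace Laplacian

namespace Summit.NavierStokesRegularity.NavierStokesRegularity.Theorems.ScenarioCensus.DenseLocus

open Literature.Analysis Literature.Analysis.FluidPDE
open Summit.NavierStokesRegularity.NavierStokesRegularity.Theorems
open Summit.NavierStokesRegularity.NavierStokesRegularity.Theorems.ScenarioCensus.LiouvilleSocket
open Summit.NavierStokesRegularity.NavierStokesRegularity.Theorems.ScenarioCensus.SharpTop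
open Summit.NavierStokesRegularity.NavierStokesRegularity.Theorems.ScenarioCensus.ThinTop
open Summit.NavierStokesRegularity.NavierStokesRegularity.Theorems.ScenarioCensus.EventSocket

/-! ## §7 TWO INSTANCES: the BELTRAMI locus `ω × u = 0` (Lamb defect) and the IRROTATIONAL locus `ω = 0` — kills via
the joint real-analyticity of `𝒦`, Mityagin's zero-set lemma and the generalised-Beltrami Liouville theorem, ALL BY NAME -/

/-! ### Analytic rigidity of slices of `𝒦` -/

/-- Slices of a Type-I ancient mild field are real-analytic (from the joint analyticity fact
`IsTypeIAncientMild.analyticAt_uncurry`, Literature). -/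
theorem analyticAt_slice {M : ℝ} {W : ℝ → E3 → E3} (hW : IsTypeIAncientMild M W) {s : ℝ} (hs : s < 0) (y : E3) :
    AnalyticAt ℝ (W s) y :=
  (hW.analyticAt_uncurry hs y).comp (analyticAt_const.prod analyticAt_id)

/-- Slices of `𝒦` are real-analytic on `ℝ³`. -/
theorem analyticOnNhd_slice {M : ℝ} {W : ℝ → E3 → E3} (hW : IsTypeIAncientMild M W) {s : ℝ} (hs : s < 0) :
    AnalyticOnNhd ℝ (W s) univ := fun y _ => analyticAt_slice hW hs y

/-- The vorticity of a slice of `𝒦` is real-analytic. -/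
theorem analyticOnNhd_curl_slice {M : ℝ} {W : ℝ → E3 → E3} (hW : IsTypeIAncientMild M W) {s : ℝ} (hs : s < 0) :
    AnalyticOnNhd ℝ (curl (W s)) univ := by
  rw [curl_eq_curlCLM_comp]
  exact curlCLM.comp_analyticOnNhd (analyticOnNhd_slice hW hs).fderiv

/-- The Lamb vector `ω × W` of a slice of `𝒦` is real-analytic. -/
theorem analyticOnNhd_lamb_slice {M : ℝ} {W : ℝ → E3 → E3} (hW : IsTypeIAncientMild M W) {s : ℝ} (hs : s < 0) :
    AnalyticOnNhd ℝ (fun y => cross (curl (W s) y) (W s y)) univ := by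
  intro y _
  have h1 : AnalyticAt ℝ (curl (W s)) y := analyticOnNhd_curl_slice hW hs y (mem_univ _)
  have h2 : AnalyticAt ℝ (W s) y := analyticAt_slice hW hs y
  have h : AnalyticAt ℝ ((fun z : E3 × E3 => crossCLM z.1 z.2) ∘ fun y => (curl (W s) y, W s y)) y :=
    AnalyticAt.comp (x := y) (f := fun y => (curl (W s) y, W s y)) (crossCLM.analyticAt_bilinear _) (h1.prod h2)
  simpa only [Function.comp_def, crossCLM_apply] using h

/-- **Mityagin on slices** (the zero-set fact `realAnalytic_zeroSet_null`, PROVED in the tree as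
`realAnalytic_zeroSet_null_holds`, applied componentwise): an `ℝ³`-valued function real-analytic on all of `ℝ³` whose
zero set has NON-ZERO Lebesgue measure vanishes identically. -/
theorem eq_zero_of_analytic_of_volume_zeroSet_ne_zero {f : E3 → E3} (hf : AnalyticOnNhd ℝ f univ)
    (hpos : volume {y : E3 | f y = 0} ≠ 0) : ∀ y, f y = 0 := by
  have hcomp : ∀ i : Fin 3, ∀ y, f y i = 0 := by
    intro i
    by_contra hne
    push Not at hne
    obtain ⟨y₀, hy₀⟩ := hne
    have hA : AnalyticOnNhd ℝ (fun y => f y i) univ := by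
      have h := (EuclideanSpace.proj (𝕜 := ℝ) i).comp_analyticOnNhd hf
      simpa [Function.comp_def] using h
    have hnull := Literature.Analysis.Calculus.realAnalytic_zeroSet_null_holds 3 univ (fun y => f y i) isOpen_univ
      isConnected_univ hA ⟨y₀, mem_univ _, hy₀⟩
    refine hpos (measure_mono_null (fun y hy => ?_) hnull)
    refine ⟨mem_univ _, ?_⟩
    have hy' : f y = 0 := hy
    simp only [hy']
    rfl
  intro y
  ext i
  exact hcomp i y

/-! ### The two defects -/

/-- The dimensionless **LAMB DEFECT** of a jet: `lambOf (V, A) = curlOf A × V`.  On the physical jet it reads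
`(T − t)^{3/2} ν^{−1/2} · (ω × u)(t,x)` (`lambOf_physJet`); its zero locus is the BELTRAMI locus `ω ∥ u`. -/
def lambOf (J : Jet) : E3 := cross (curlOf J.2) J.1

/-- The dimensionless **VORTICITY** of a jet: `vortOf (V, A) = curlOf A`.  On the physical jet it reads `(T − t) · ω(t,x)`
(`vortOf_physJet`); its zero locus is the IRROTATIONAL locus. -/
def vortOf (J : Jet) : E3 := curlOf J.2

/-- The vorticity defect is continuous. -/
theorem continuous_vortOf : Continuous vortOf :=
  continuous_curlOf.comp continuous_snd

/-- The Lamb defect is continuous. -/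
theorem continuous_lambOf : Continuous lambOf := by
  have h : Continuous fun J : Jet => crossCLM (curlOf J.2) J.1 :=
    crossCLM.continuous₂.comp ((continuous_curlOf.comp continuous_snd).prodMk continuous_fst)
  show Continuous fun J : Jet => cross (curlOf J.2) J.1
  simpa only [crossCLM_apply] using h

/-- Physical reading of the Lamb defect. -/
theorem lambOf_physJet (T ν : ℝ) (u : ℝ → E3 → E3) (t : ℝ) (x : E3) :
    lambOf (physJet T ν u t x) = ((T - t) * Real.sqrt ((T - t) / ν)) • cross (curl (u t) x) (u t x) := by
  simp only [lambOf, physJet, curlOf_smul, UnthreadedRigidity.ThreadingJets.cross_smul_smul, curl_eq_curlOf]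

/-- Physical reading of the vorticity defect. -/
theorem vortOf_physJet (T ν : ℝ) (u : ℝ → E3 → E3) (t : ℝ) (x : E3) :
    vortOf (physJet T ν u t x) = (T - t) • curl (u t) x := by
  simp only [vortOf, physJet, curlOf_smul, curl_eq_curlOf]

/-- The `ε`-near-Beltrami slice: `(T − t)^{3/2} ν^{−1/2} ‖ω × u‖ < ε` at `(t, x)` (`t < T`). -/
theorem mem_eventSlice_nearEv_lambOf_iff {T ν ε t : ℝ} (ht : t < T) (u : ℝ → E3 → E3) (x : E3) :
    x ∈ eventSlice (NearEv lambOf ε) T ν u t ↔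
      (T - t) * Real.sqrt ((T - t) / ν) * ‖cross (curl (u t) x) (u t x)‖ < ε := by
  have h0 : 0 ≤ (T - t) * Real.sqrt ((T - t) / ν) := mul_nonneg (sub_pos.2 ht).le (Real.sqrt_nonneg _)
  rw [mem_eventSlice_nearEv_iff, lambOf_physJet, norm_smul, Real.norm_eq_abs, abs_of_nonneg h0]

/-- The `ε`-calm slice: `(T − t) ‖ω(t,x)‖ < ε` (`t < T`). -/
theorem mem_eventSlice_nearEv_vortOf_iff {T ν ε t : ℝ} (ht : t < T) (u : ℝ → E3 → E3) (x : E3) :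
    x ∈ eventSlice (NearEv vortOf ε) T ν u t ↔ (T - t) * ‖curl (u t) x‖ < ε := by
  rw [mem_eventSlice_nearEv_iff, vortOf_physJet, norm_smul, Real.norm_eq_abs, abs_of_pos (sub_pos.2 ht)]

/-- Ancient reading of the Lamb defect. -/
theorem lambOf_ancientJet (W : ℝ → E3 → E3) (s : ℝ) (y : E3) :
    lambOf (ancientJet W s y) = ((-s) * Real.sqrt (-s)) • cross (curl (W s) y) (W s y) := by
  simp only [lambOf, ancientJet, curlOf_smul, UnthreadedRigidity.ThreadingJets.cross_smul_smul, curl_eq_curlOf]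

/-- Ancient reading of the vorticity defect. -/
theorem vortOf_ancientJet (W : ℝ → E3 → E3) (s : ℝ) (y : E3) :
    vortOf (ancientJet W s y) = (-s) • curl (W s) y := by
  simp only [vortOf, ancientJet, curlOf_smul, curl_eq_curlOf]

/-- The exact Beltrami locus of a slice of the limit (`s < 0`). -/
theorem lambOf_ancientJet_eq_zero_iff (W : ℝ → E3 → E3) {s : ℝ} (hs : s < 0) (y : E3) :
    lambOf (ancientJet W s y) = 0 ↔ cross (curl (W s) y) (W s y) = 0 := by
  have hs' : 0 < -s := neg_pos.2 hs
  have hne : (-s) * Real.sqrt (-s) ≠ 0 := (mul_pos hs' (Real.sqrt_pos.2 hs')).ne'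
  rw [lambOf_ancientJet, smul_eq_zero, or_iff_right hne]

/-- The exact irrotational locus of a slice of the limit (`s < 0`). -/
theorem vortOf_ancientJet_eq_zero_iff (W : ℝ → E3 → E3) {s : ℝ} (hs : s < 0) (y : E3) :
    vortOf (ancientJet W s y) = 0 ↔ curl (W s) y = 0 := by
  rw [vortOf_ancientJet, smul_eq_zero, or_iff_right (neg_pos.2 hs).ne']

/-! ### The two KILLS (generalised-Beltrami Liouville theorem of the tree, BY NAME) -/

/-- **The Beltrami locus kills**: a field of `𝒦` whose exact Beltrami locus `{ω × W = 0}` has non-zero measure on every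
slice is Beltrami on every slice (Mityagin + analyticity), hence generalised Beltrami, hence trivial
(`SimilarityEnstrophy.typeI_ancient_eq_zero_of_generalisedBeltrami`). -/
theorem locusKills_lambOf : LocusKills lambOf := by
  intro M W hW hpos
  refine SimilarityEnstrophy.typeI_ancient_eq_zero_of_generalisedBeltrami hW fun s hs => ?_
  have hzero : ∀ y, cross (curl (W s) y) (W s y) = 0 := by
    have h := hpos s hs
    have e : {y : E3 | lambOf (ancientJet W s y) = 0} = {y | cross (curl (W s) y) (W s y) = 0} := by
      ext y; simp only [mem_setOf_eq, lambOf_ancientJet_eq_zero_iff W hs]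
    rw [e] at h
    exact eq_zero_of_analytic_of_volume_zeroSet_ne_zero (analyticOnNhd_lamb_slice hW hs) h
  intro x
  rw [show (fun y => cross (curl (W s) y) (W s y)) = fun _ => (0 : E3) from funext hzero]
  exact curl_const 0 x

/-- **The irrotational locus kills**: a non-null irrotational locus on every slice makes every slice irrotational
(Mityagin + analyticity), so `ω × W ≡ 0` and the generalised-Beltrami Liouville theorem applies. -/
theorem locusKills_vortOf : LocusKills vortOf := by
  intro M W hW hpos
  refine SimilarityEnstrophy.typeI_ancient_eq_zero_of_generalisedBeltrami hW fun s hs => ?_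
  have hzero : ∀ y, curl (W s) y = 0 := by
    have h := hpos s hs
    have e : {y : E3 | vortOf (ancientJet W s y) = 0} = {y | curl (W s) y = 0} := by
      ext y; simp only [mem_setOf_eq, vortOf_ancientJet_eq_zero_iff W hs]
    rw [e] at h
    exact eq_zero_of_analytic_of_volume_zeroSet_ne_zero (analyticOnNhd_curl_slice hW hs) h
  intro x
  have hfun : (fun y => cross (curl (W s) y) (W s y)) = fun _ => (0 : E3) := by
    funext y; simp [hzero y, ← crossCLM_apply]
  rw [hfun]
  exact curl_const 0 x

/-! ## §8 THE NAMED ROWS, FLOORS AND RESIDUALS (criterion rows PROVED; residuals ≡ `Row_F1`, not claimed) -/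

/-- **Row «BELTRAMI-DENSE END» (`Row_F1bel`, PROVED).**  In the frame of `Row_F1`: if for some `δ, ρ > 0` and every
`ε > 0`, at all times close enough to `T`, the `ε`-NEAR-BELTRAMI points
`{x : (T − t)^{3/2} ν^{−1/2} ‖ω(t,x) × u(t,x)‖ < ε}` fill at least the fraction `δ` of EVERY ball of radius
`ρ√(ν(T − t))`, then the solution extends smoothly past `T` (no Type-I blow-up).  Magnitude-blind AND sign-blind: only
the MEASURE of an approximate-alignment set is charged. -/
def Row_F1bel : Prop :=
  ∀ (ν T : ℝ), 0 < ν → 0 < T → ∀ (u : ℝ → E3 → E3) (p : ℝ → E3 → ℝ),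
    IsClassicalNSSolutionOn (Ico 0 T) ν 0 u p → IsLerayHopfOn T ν 0 (u 0) u → HasRapidSpatialDecay (u 0) →
    IsTypeIBlowup u T → DenseNear lambOf T ν u → HasSmoothExtensionPast ν 0 u T

/-- **Row «CALM-DENSE END» (`Row_F1calm`, PROVED).**  Same frame: if the `ε`-CALM points `{x : (T − t)‖ω(t,x)‖ < ε}`
are asymptotically `δ`-dense in every parabolic ball (every `ε > 0`), the solution extends smoothly past `T`. -/
def Row_F1calm : Prop :=
  ∀ (ν T : ℝ), 0 < ν → 0 < T → ∀ (u : ℝ → E3 → E3) (p : ℝ → E3 → ℝ),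
    IsClassicalNSSolutionOn (Ico 0 T) ν 0 u p → IsLerayHopfOn T ν 0 (u 0) u → HasRapidSpatialDecay (u 0) →
    IsTypeIBlowup u T → DenseNear vortOf T ν u → HasSmoothExtensionPast ν 0 u T

/-- **Floor «RECURRENT TWISTED BALLS» (`RecurrentTwistedBalls`, PROVED).**  At every maximal Type-I Clay blow-up: for
all `δ, ρ > 0` there is `ε > 0` such that at times arbitrarily close to `T` some ball `B(x, ρ√(ν(T−t)))` has LESS than
the fraction `δ` of `ε`-near-Beltrami points — i.e. it is `(1 − δ)`-FILLED by `ε`-TWISTED points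
`(T − t)^{3/2} ν^{−1/2}‖ω × u‖ ≥ ε`: nonlinearity depletion by Beltrami alignment fails on almost all of a parabolic ball,
recurrently.  A NEW necessary feature of Type-I blow-up. -/
def RecurrentTwistedBalls : Prop :=
  ∀ (ν T : ℝ), 0 < ν → 0 < T → ∀ (u : ℝ → E3 → E3) (p : ℝ → E3 → ℝ),
    IsMaximalSmoothSolution ν 0 u p T → IsLerayHopfOn T ν 0 (u 0) u → HasRapidSpatialDecay (u 0) →
    IsTypeIBlowup u T → ¬ DenseNear lambOf T ν u

/-- **Floor «RECURRENT VORTICAL BALLS» (`RecurrentVorticalBalls`, PROVED).**  At every maximal Type-I Clay blow-up: for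
all `δ, ρ > 0` there is `ε > 0` such that, recurrently as `t ↑ T`, some parabolic ball `B(x, ρ√(ν(T−t)))` is
`(1 − δ)`-FILLED by vorticity of self-similar size `‖ω‖ ≥ ε/(T − t)`. -/
def RecurrentVorticalBalls : Prop :=
  ∀ (ν T : ℝ), 0 < ν → 0 < T → ∀ (u : ℝ → E3 → E3) (p : ℝ → E3 → ℝ),
    IsMaximalSmoothSolution ν 0 u p T → IsLerayHopfOn T ν 0 (u 0) u → HasRapidSpatialDecay (u 0) →
    IsTypeIBlowup u T → ¬ DenseNear vortOf T ν u

/-- **Residual «BELTRAMI SLACK» (`BelSlack` ≡ `Row_F1`, NOT claimed)**: every maximal Type-I blow-up is Beltrami-dense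
at the end. -/
@[conjecture] def BelSlack : Prop :=
  ∀ (ν T : ℝ), 0 < ν → 0 < T → ∀ (u : ℝ → E3 → E3) (p : ℝ → E3 → ℝ),
    IsMaximalSmoothSolution ν 0 u p T → IsLerayHopfOn T ν 0 (u 0) u → HasRapidSpatialDecay (u 0) →
    IsTypeIBlowup u T → DenseNear lambOf T ν u

/-- **Residual «CALM SLACK» (`CalmSlack` ≡ `Row_F1`, NOT claimed)**. -/
@[conjecture] def CalmSlack : Prop :=
  ∀ (ν T : ℝ), 0 < ν → 0 < T → ∀ (u : ℝ → E3 → E3) (p : ℝ → E3 → ℝ),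
    IsMaximalSmoothSolution ν 0 u p T → IsLerayHopfOn T ν 0 (u 0) u → HasRapidSpatialDecay (u 0) →
    IsTypeIBlowup u T → DenseNear vortOf T ν u

/-- `Row_F1bel` is the engine row of the Lamb defect. -/
theorem row_F1bel_eq : Row_F1bel = LocRow lambOf := rfl
/-- `Row_F1calm` is the engine row of the vorticity defect. -/
theorem row_F1calm_eq : Row_F1calm = LocRow vortOf := rfl
/-- The floor RTB is the engine floor of the Lamb defect. -/
theorem recurrentTwistedBalls_eq : RecurrentTwistedBalls = LocFloor lambOf := rfl
/-- The floor RVB is the engine floor of the vorticity defect. -/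
theorem recurrentVorticalBalls_eq : RecurrentVorticalBalls = LocFloor vortOf := rfl
/-- `BelSlack` is the engine slack of the Lamb defect. -/
theorem belSlack_eq : BelSlack = LocSlack lambOf := rfl
/-- `CalmSlack` is the engine slack of the vorticity defect. -/
theorem calmSlack_eq : CalmSlack = LocSlack vortOf := rfl

/-- **`Row_F1bel` PROVED.** -/
theorem rowF1bel_holds : Row_F1bel := locRow_of_kills continuous_lambOf locusKills_lambOf

/-- **`Row_F1calm` PROVED.** -/
theorem rowF1calm_holds : Row_F1calm := locRow_of_kills continuous_vortOf locusKills_vortOf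

/-- **`RecurrentTwistedBalls` PROVED.** -/
theorem recurrentTwistedBalls_holds : RecurrentTwistedBalls := locFloor_of_kills continuous_lambOf locusKills_lambOf

/-- **`RecurrentVorticalBalls` PROVED.** -/
theorem recurrentVorticalBalls_holds : RecurrentVorticalBalls := locFloor_of_kills continuous_vortOf locusKills_vortOf

/-- The twisted-balls floor, read physically. -/
theorem recurrentTwistedBalls_reading {ν T : ℝ} (hν : 0 < ν) (hT : 0 < T) {u : ℝ → E3 → E3} {p : ℝ → E3 → ℝ}
    (hmax : IsMaximalSmoothSolution ν 0 u p T) (hLH : IsLerayHopfOn T ν 0 (u 0) u)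
    (hdec : HasRapidSpatialDecay (u 0)) (hTI : IsTypeIBlowup u T) :
    ∀ δ : ℝ, 0 < δ → ∀ ρ : ℝ, 0 < ρ → ∃ ε : ℝ, 0 < ε ∧ ∀ t₁ : ℝ, t₁ < T → ∃ t ∈ Ioo t₁ T, ∃ x : E3,
      volume (eventSlice (NearEv lambOf ε) T ν u t ∩ ball x (ρ * Real.sqrt (ν * (T - t)))) <
        ENNReal.ofReal δ * volume (ball x (ρ * Real.sqrt (ν * (T - t)))) :=
  (not_denseNear_iff lambOf T ν u).1 (recurrentTwistedBalls_holds ν T hν hT u p hmax hLH hdec hTI)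

/-- **Split**: `Row_F1bel → BelSlack → Row_F1`. -/
theorem rowF1_of_bel (hR : Row_F1bel) (hS : BelSlack) : ScenarioCensus.Row_F1 := rowF1_of_locRow hR hS

/-- **Split**: `Row_F1calm → CalmSlack → Row_F1`. -/
theorem rowF1_of_calm (hR : Row_F1calm) (hS : CalmSlack) : ScenarioCensus.Row_F1 := rowF1_of_locRow hR hS

/-- `Row_F1` gives the Beltrami slack. -/
theorem belSlack_of_rowF1 (h : ScenarioCensus.Row_F1) : BelSlack := locSlack_of_rowF1 lambOf h
/-- `Row_F1` gives the calm slack. -/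
theorem calmSlack_of_rowF1 (h : ScenarioCensus.Row_F1) : CalmSlack := locSlack_of_rowF1 vortOf h

/-- **The Beltrami residual is EQUIVALENT to `Row_F1`** (honest label). -/
theorem belSlack_iff_rowF1 : BelSlack ↔ ScenarioCensus.Row_F1 := locSlack_iff_rowF1 continuous_lambOf locusKills_lambOf

/-- **The calm residual is EQUIVALENT to `Row_F1`** (honest label). -/
theorem calmSlack_iff_rowF1 : CalmSlack ↔ ScenarioCensus.Row_F1 := locSlack_iff_rowF1 continuous_vortOf locusKills_vortOf

/-- **SUMMARY of the line.**  The two criterion rows and the two floors are theorems; the residuals are `Row_F1`. -/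
theorem denseLocus_summary :
    Row_F1bel ∧ Row_F1calm ∧ RecurrentTwistedBalls ∧ RecurrentVorticalBalls ∧
      (BelSlack ↔ ScenarioCensus.Row_F1) ∧ (CalmSlack ↔ ScenarioCensus.Row_F1) :=
  ⟨rowF1bel_holds, rowF1calm_holds, recurrentTwistedBalls_holds, recurrentVorticalBalls_holds, belSlack_iff_rowF1,
    calmSlack_iff_rowF1⟩

end Summit.NavierStokesRegularity.NavierStokesRegularity.Theorems.ScenarioCensus.DenseLocus

namespace Summit.NavierStokesRegularity.NavierStokesRegularity.Theorems.ScenarioCensus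

/-! ## Census KEYS (ns `…Theorems.ScenarioCensus`): the DENSE-LOCUS members of row F1 (LINE 31) — TREE-decided F1βd (`Row_F1bel`) / F1ωd (`Row_F1calm`) and floors RTB / RVB -/

/-- **Cell F1βd «BELTRAMI-DENSE END»** (row F1 frame VERBATIM + `∃ δ, ρ > 0 ∀ ε > 0`, at all late times the `ε`-near-Beltrami points `{(T−t)^{3/2}ν^{−1/2}‖ω × u‖ < ε}` fill at least the fraction `δ` of every ball of radius `ρ√(ν(T−t))` ⇒ smooth extension past `T`): `:= DenseLocus.Row_F1bel`. DECIDED. -/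
def Row_F1bel : Prop := DenseLocus.Row_F1bel
/-- F1bel is EXCLUDED (decided in the tree): `DenseLocus.rowF1bel_holds`. -/
theorem row_F1bel_excluded : Row_F1bel := DenseLocus.rowF1bel_holds

/-- **Cell F1ωd «CALM-DENSE END»** (same with the `ε`-calm points `{(T−t)‖ω‖ < ε}`): `:= DenseLocus.Row_F1calm`. DECIDED. -/
def Row_F1calm : Prop := DenseLocus.Row_F1calm
/-- F1calm is EXCLUDED (decided in the tree): `DenseLocus.rowF1calm_holds`. -/
theorem row_F1calm_excluded : Row_F1calm := DenseLocus.rowF1calm_holds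

/-- **Floor RTB — RECURRENT TWISTED BALLS**: `DenseLocus.recurrentTwistedBalls_holds`. -/
theorem row_F1_recurrentTwistedBalls : DenseLocus.RecurrentTwistedBalls := DenseLocus.recurrentTwistedBalls_holds
/-- **Floor RVB — RECURRENT VORTICAL BALLS**: `DenseLocus.recurrentVorticalBalls_holds`. -/
theorem row_F1_recurrentVorticalBalls : DenseLocus.RecurrentVorticalBalls := DenseLocus.recurrentVorticalBalls_holds

end Summit.NavierStokesRegularity.NavierStokesRegularity.Theorems.ScenarioCensus

end
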